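import Mathlib.NumberTheory.Chebyshev
import Mathlib.Analysis.SpecialFunctions.Log.Deriv
import Mathlib.Analysis.SpecialFunctions.Pow.Deriv
import Mathlib.MeasureTheory.Integral.IntervalIntegral.FundThmCalculus
import Mathlib.Analysis.Calculus.Deriv.MeanValue
import Mathlib.Topology.Algebra.Order.LiminfLimsup
import Literature.NumberTheory.LFunctions.ChebyshevPsiLogPowerError
import HarnessLib

/-!
# RH-FREE: the limits defining Bombieri–Lagarias' `η_k` exist

Topic `Literature/NumberTheory/LFunctions` (siblings: `LiCoefficientArithmeticFormula.lean` — `liEtaSeq k N =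
Σ_{m≤N} Λ(m)(log m)^k/m − (log N)^{k+1}/(k+1)` and `liEta k = ((−1)^k/k!)·lim`, the vocabulary of the column LI;
`ZetaLogDerivTaylorPrimes.lean` — the Abelian (`s → 1⁺`) form of the arithmetic formula;
`ChebyshevPsiLogPowerError.lean` — `ψ(x) − x = O(x/(log x)^A)`, proved).  Everything here is PROVED;
no definitions; **RH-FREE**.

Bombieri–Lagarias (1999, Thm. 2) and Coffey (2005, (11); 2010, (5)) define
`η_k = ((−1)^k/k!) lim_{N→∞} (Σ_{m≤N} Λ(m)(log m)^k/m − (log N)^{k+1}/(k+1))`; the existence of this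
limit is the first clause of the named fact `Coffey2005_thm1`.  This file proves it:

* `tendsto_sum_log_pow_div_sub_exists` — the generalized Euler (Stieltjes-type) constants exist:
  `Σ_{m≤N} (log m)^k/m − (log N)^{k+1}/(k+1)` converges (the sequence is non-increasing from
  `N ≥ e^k` on, where `(log x)^k/x` decreases, and bounded below);
* `tendsto_sum_vonMangoldt_log_pow_div_sub_exists` — **the `η_k`-limits exist**:
  `Σ_{m≤N} Λ(m)(log m)^k/m − (log N)^{k+1}/(k+1)` converges, for every `k`.  Proof: write
  `Λ(m) = 1 + (Λ(m) − 1)`; the first part is the previous bullet; for the second, Abel summation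
  against `C(n) = Σ_{m≤n}(Λ(m) − 1) = ψ(n) − n = O(n/(log n)^{k+2})`
  (`PsiLogPower.chebyshevPsi_sub_self_isBigO_div_logPow`): the boundary term is `O(1/log² N) → 0` and
  the Abel series is dominated by `Σ 1/(m log² m) < ∞` (`(log m)^k/m − (log(m+1))^k/(m+1) ≤
  (log(m+1))^k/(m(m+1))`).

The identification of the limit with `(−1)^{k+1} k!·q_k` (`q_k = (ζ₁'/ζ₁)^{(k)}(1)/k!`), i.e. the second
clause of `Coffey2005_thm1`, needs in addition an Abelian comparison with
`ZetaLogDerivTaylorPrimes.tendsto_LSeries_vonMangoldt_logPow_sub` and is NOT done here.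

## References

* E. Bombieri, J. C. Lagarias, *Complements to Li's criterion for the Riemann hypothesis*, J. Number
  Theory 77 (1999), 274–287, Thm. 2. [BombieriLagarias1999]
* M. W. Coffey, *The Stieltjes constants, their relation to the `η_j` coefficients, and representation of
  the Hurwitz zeta function*, Analysis 30 (2010), 383–409, eqs. (2), (5) (held: `paper:arxiv-0706.0343`,
  p. 2). [Coffey2010Eta]
* M. W. Coffey, Math. Phys. Anal. Geom. 8 (2005) 211–255, eq. (11). [Coffey2005LiCriterion]
-/

noncomputable section

open Filter Topology Finset Real

namespace Literature.NumberTheory.LFunctions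

/-- `d/dx [(log x)^{k+1}/(k+1)] = (log x)^k/x` for `x > 0`. [folklore] -/
private theorem hasDerivAt_F (k : ℕ) {x : ℝ} (hx : 0 < x) : HasDerivAt (fun y : ℝ ↦ Real.log y ^ (k + 1) / ((k : ℝ) + 1)) (Real.log x ^ k / x) x := by
  have h : HasDerivAt (fun y ↦ Real.log y ^ (k + 1) / ((k : ℝ) + 1))
      ((((k + 1 : ℕ) : ℝ) * Real.log x ^ (k + 1 - 1) * x⁻¹) / ((k : ℝ) + 1)) x :=
    ((Real.hasDerivAt_log hx.ne').pow (k + 1)).div_const ((k : ℝ) + 1)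
  have e : (((k + 1 : ℕ) : ℝ) * Real.log x ^ (k + 1 - 1) * x⁻¹) / ((k : ℝ) + 1) = (Real.log (x : ℝ) ^ k / (x : ℝ)) := by
    have hk : ((k : ℝ) + 1) ≠ 0 := by positivity
    rw [Nat.add_sub_cancel]
    push_cast
    field_simp
  rw [e] at h
  exact h

/-- `d/dx [(log x)^k/x] = (k (log x)^{k−1} − (log x)^k)/x²` for `x > 0`. [folklore] -/
private theorem hasDerivAt_f (k : ℕ) {x : ℝ} (hx : 0 < x) :
    HasDerivAt (fun y : ℝ ↦ Real.log y ^ k / y) (((k : ℝ) * Real.log x ^ (k - 1) - Real.log x ^ k) / x ^ 2) x := by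
  have h : HasDerivAt (fun y ↦ Real.log y ^ k / y)
      (((k : ℝ) * Real.log x ^ (k - 1) * x⁻¹ * x - Real.log x ^ k * 1) / x ^ 2) x :=
    ((Real.hasDerivAt_log hx.ne').pow k).div (hasDerivAt_id x) hx.ne'
  have e : ((k : ℝ) * Real.log x ^ (k - 1) * x⁻¹ * x - Real.log x ^ k * 1) / x ^ 2 =
      ((k : ℝ) * Real.log x ^ (k - 1) - Real.log x ^ k) / x ^ 2 := by
    rw [inv_mul_cancel_right₀ hx.ne', mul_one]
  rw [e] at h
  exact h

/-- `f_k` is antitone on `[exp k, ∞)`. [folklore] -/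
private theorem f_antitoneOn (k : ℕ) : AntitoneOn (fun y : ℝ ↦ Real.log y ^ k / y) (Set.Ici (Real.exp k)) := by
  have hpos : ∀ x ∈ Set.Ici (Real.exp k), 0 < x := fun x hx ↦ (Real.exp_pos _).trans_le hx
  refine antitoneOn_of_deriv_nonpos (convex_Ici _) ?_ ?_ ?_
  · exact fun x hx ↦ (hasDerivAt_f k (hpos x hx)).continuousAt.continuousWithinAt
  · intro x hx
    rw [interior_Ici] at hx
    exact (hasDerivAt_f k ((Real.exp_pos _).trans hx)).differentiableAt.differentiableWithinAt
  · intro x hx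
    rw [interior_Ici] at hx
    have hx0 : 0 < x := (Real.exp_pos _).trans hx
    rw [(hasDerivAt_f k hx0).deriv]
    apply div_nonpos_of_nonpos_of_nonneg _ (by positivity)
    have hlog : (k : ℝ) ≤ Real.log x := by
      rw [Real.le_log_iff_exp_le hx0]; exact hx.le
    have hlog0 : 0 ≤ Real.log x := (Nat.cast_nonneg k).trans hlog
    rcases Nat.eq_zero_or_pos k with rfl | hk
    · simp
    · have : (k : ℝ) * Real.log x ^ (k - 1) ≤ Real.log x ^ k := by
        calc (k : ℝ) * Real.log x ^ (k - 1) ≤ Real.log x * Real.log x ^ (k - 1) :=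
              mul_le_mul_of_nonneg_right hlog (by positivity)
          _ = Real.log x ^ k := by rw [← pow_succ', Nat.sub_add_cancel hk]
      linarith

/-- `(log x)^k/x ≥ 0` for `x ≥ 1`. [folklore] -/
private theorem f_nonneg (k : ℕ) {x : ℝ} (hx : 1 ≤ x) : 0 ≤ (Real.log (x : ℝ) ^ k / (x : ℝ)) := by
  exact div_nonneg (pow_nonneg (Real.log_nonneg hx) _) (by linarith)

/-- `F(N+1) − F(N) = ∫_N^{N+1} f` for `N ≥ 1`, squeezed between `f(N+1)` and `f(N)` when
`exp k ≤ N`. [folklore] -/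
private theorem F_succ_sub_mem (k : ℕ) {N : ℕ} (hN : Real.exp k ≤ N) :
    (Real.log ((N + 1) : ℝ) ^ k / ((N + 1) : ℝ)) ≤ (Real.log ((N + 1) : ℝ) ^ (k + 1) / ((k : ℝ) + 1)) - (Real.log (N : ℝ) ^ (k + 1) / ((k : ℝ) + 1)) ∧ (Real.log ((N + 1) : ℝ) ^ (k + 1) / ((k : ℝ) + 1)) - (Real.log (N : ℝ) ^ (k + 1) / ((k : ℝ) + 1)) ≤ (Real.log (N : ℝ) ^ k / (N : ℝ)) := by
  have hN0 : (0 : ℝ) < N := (Real.exp_pos _).trans_le hN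
  have hint : ∫ x in (N : ℝ)..(N + 1), Real.log x ^ k / x =
      (Real.log ((N : ℝ) + 1) ^ (k + 1) / ((k : ℝ) + 1)) - (Real.log (N : ℝ) ^ (k + 1) / ((k : ℝ) + 1)) := by
    have h0 := intervalIntegral.integral_eq_sub_of_hasDerivAt
      (f := fun y : ℝ ↦ Real.log y ^ (k + 1) / ((k : ℝ) + 1)) (f' := fun y : ℝ ↦ Real.log y ^ k / y)
      (a := (N : ℝ)) (b := (N : ℝ) + 1) ?_ ?_
    · exact h0
    · intro x hx
      rw [Set.uIcc_of_le (by linarith)] at hx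
      exact hasDerivAt_F k (by linarith [hx.1])
    · apply ContinuousOn.intervalIntegrable
      intro x hx
      rw [Set.uIcc_of_le (by linarith)] at hx
      exact (hasDerivAt_f k (by linarith [hx.1])).continuousAt.continuousWithinAt
  rw [← hint]
  have hcont : ContinuousOn (fun y : ℝ ↦ Real.log y ^ k / y) (Set.Icc (N : ℝ) (N + 1)) := fun x hx ↦
    (hasDerivAt_f k (by linarith [hx.1])).continuousAt.continuousWithinAt
  have hanti := f_antitoneOn k
  constructor
  · have h := intervalIntegral.integral_mono_on (f := fun _ ↦ Real.log ((N:ℝ) + 1) ^ k / ((N:ℝ) + 1)) (g := fun y : ℝ ↦ Real.log y ^ k / y) (μ := MeasureTheory.volume)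
      (by linarith : (N : ℝ) ≤ N + 1) (by simp) (hcont.intervalIntegrable_of_Icc (by linarith))
      (fun x hx ↦ hanti (Set.mem_Ici.2 (hN.trans hx.1)) (Set.mem_Ici.2 (by linarith [hx.1])) hx.2)
    simpa using h
  · have h := intervalIntegral.integral_mono_on (f := fun y : ℝ ↦ Real.log y ^ k / y) (g := fun _ ↦ Real.log (N:ℝ) ^ k / (N:ℝ)) (μ := MeasureTheory.volume)
      (by linarith : (N : ℝ) ≤ N + 1) (hcont.intervalIntegrable_of_Icc (by linarith)) (by simp)
      (fun x hx ↦ hanti (Set.mem_Ici.2 hN) (Set.mem_Ici.2 (hN.trans hx.1)) hx.1)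
    simpa using h

/-- One step of the Stieltjes-type sequence. [folklore] -/
private theorem u_succ (k N : ℕ) : ((∑ m ∈ Icc 1 (N + 1), Real.log (m : ℝ) ^ k / (m : ℝ)) - Real.log (((N + 1) : ℕ) : ℝ) ^ (k + 1) / ((k : ℝ) + 1)) = ((∑ m ∈ Icc 1 N, Real.log (m : ℝ) ^ k / (m : ℝ)) - Real.log ((N : ℕ) : ℝ) ^ (k + 1) / ((k : ℝ) + 1)) + (Real.log ((N + 1) : ℝ) ^ k / ((N + 1) : ℝ)) - ((Real.log ((N + 1) : ℝ) ^ (k + 1) / ((k : ℝ) + 1)) - (Real.log (N : ℝ) ^ (k + 1) / ((k : ℝ) + 1))) := by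
  rw [Finset.sum_Icc_succ_top (by omega)]
  push_cast
  ring

/-- **The generalized Euler (Stieltjes-type) constants exist**: for every `k`,
`Σ_{m≤N} (log m)^k/m − (log N)^{k+1}/(k+1)` converges as `N → ∞` (Coffey 2010, (2):
`γ_k = lim (Σ_{m≤N} (log m)^k/m − (log N)^{k+1}/(k+1))`; the sequence is non-increasing from `N ≥ e^k` on
and bounded below). [cite: Coffey2010Eta, eq. (2)] -/
theorem tendsto_sum_log_pow_div_sub_exists (k : ℕ) : ∃ L : ℝ, Tendsto (fun N : ℕ ↦ (∑ m ∈ Icc 1 N, Real.log (m : ℝ) ^ k / (m : ℝ)) - Real.log (N : ℝ) ^ (k + 1) / ((k : ℝ) + 1)) atTop (𝓝 L) := by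
  obtain ⟨N₀, hN₀⟩ := exists_nat_ge (Real.exp k)
  have hN₀1 : 1 ≤ N₀ := by
    have : (1 : ℝ) ≤ N₀ := (Real.one_le_exp (Nat.cast_nonneg k)).trans hN₀
    exact_mod_cast this
  -- shifted sequence
  set v : ℕ → ℝ := fun j ↦ ((∑ m ∈ Icc 1 (j + N₀), Real.log (m : ℝ) ^ k / (m : ℝ)) - Real.log (((j + N₀) : ℕ) : ℝ) ^ (k + 1) / ((k : ℝ) + 1)) with hv
  have hstep : ∀ j : ℕ, v (j + 1) ≤ v j ∧
      v j + ((Real.log ((((j + N₀ : ℕ) : ℝ) + 1) : ℝ) ^ k / ((((j + N₀ : ℕ) : ℝ) + 1) : ℝ)) - (Real.log (((j + N₀ : ℕ) : ℝ) : ℝ) ^ k / (((j + N₀ : ℕ) : ℝ) : ℝ))) ≤ v (j + 1) := by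
    intro j
    have hN : Real.exp k ≤ ((j + N₀ : ℕ) : ℝ) := hN₀.trans (by exact_mod_cast Nat.le_add_left N₀ j)
    have h := F_succ_sub_mem k hN
    have e : v (j + 1) = ((∑ m ∈ Icc 1 ((j + N₀) + 1), Real.log (m : ℝ) ^ k / (m : ℝ)) - Real.log ((((j + N₀) + 1) : ℕ) : ℝ) ^ (k + 1) / ((k : ℝ) + 1)) := by
      simp only [hv, show j + 1 + N₀ = j + N₀ + 1 by ring]
    rw [e, u_succ]
    constructor <;> linarith [h.1, h.2]
  have hanti : Antitone v := antitone_nat_of_succ_le fun j ↦ (hstep j).1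
  have hbdd : BddBelow (Set.range v) := by
    refine ⟨v 0 - (Real.log (((0 + N₀ : ℕ) : ℝ) : ℝ) ^ k / (((0 + N₀ : ℕ) : ℝ) : ℝ)), ?_⟩
    rintro _ ⟨j, rfl⟩
    -- telescoping lower bound: v j ≥ v 0 + f(j+N₀) − f(N₀)
    have key : ∀ j : ℕ, v 0 + ((Real.log (((j + N₀ : ℕ) : ℝ) : ℝ) ^ k / (((j + N₀ : ℕ) : ℝ) : ℝ)) - (Real.log (((0 + N₀ : ℕ) : ℝ) : ℝ) ^ k / (((0 + N₀ : ℕ) : ℝ) : ℝ))) ≤ v j := by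
      intro j
      induction j with
      | zero => simp
      | succ j ih =>
        have h2 := (hstep j).2
        have e : (((j + 1 + N₀ : ℕ) : ℝ)) = ((j + N₀ : ℕ) : ℝ) + 1 := by push_cast; ring
        rw [e]
        linarith
    have hf0 : 0 ≤ (Real.log (((j + N₀ : ℕ) : ℝ) : ℝ) ^ k / (((j + N₀ : ℕ) : ℝ) : ℝ)) :=
      f_nonneg k (by exact_mod_cast (hN₀1.trans (Nat.le_add_left _ _)))
    have := key j
    linarith
  have hconv : Tendsto v atTop (𝓝 (⨅ j, v j)) := tendsto_atTop_ciInf hanti hbdd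
  exact ⟨⨅ j, v j, (tendsto_add_atTop_iff_nat N₀).1 hconv⟩

/-! ### Part (b): the prime part `Σ_{m≤N} (Λ(m) − 1) f_k(m)` converges -/

open scoped ArithmeticFunction.vonMangoldt Chebyshev

/-- `C(n) = Σ_{i<n} (Λ(i+1) − 1) = ψ(n) − n`. [folklore] -/
private theorem sum_range_vonMangoldt_sub_one (n : ℕ) :
    ∑ i ∈ Finset.range n, ((Λ (i + 1) : ℝ) - 1) = ψ (n : ℝ) - n := by
  induction n with
  | zero => simp [Chebyshev.psi]
  | succ n ih =>
    rw [Finset.sum_range_succ, ih]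
    have h1 : ψ ((n + 1 : ℕ) : ℝ) = ψ (n : ℝ) + Λ (n + 1) := by
      simp only [Chebyshev.psi, Nat.floor_natCast]
      rw [Finset.sum_Ioc_succ_top (Nat.zero_le n)]
    have e : (((n + 1 : ℕ) : ℝ)) = (n : ℝ) + 1 := by push_cast; ring
    rw [e] at h1
    push_cast
    rw [h1]
    ring

/-- An explicit form of `ψ(x) − x = O(x/(log x)^{k+2})` along the integers. [folklore] -/
private theorem exists_bound_psi_sub (k : ℕ) :
    ∃ C : ℝ, 0 ≤ C ∧ ∃ N₁ : ℕ, 2 ≤ N₁ ∧ ∀ n : ℕ, N₁ ≤ n →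
      |ψ (n : ℝ) - n| ≤ C * n / Real.log n ^ (k + 2) := by
  have h := PsiLogPower.chebyshevPsi_sub_self_isBigO_div_logPow ((k + 2 : ℕ) : ℝ)
  obtain ⟨C, hC0, hC⟩ := h.exists_nonneg
  rw [Asymptotics.IsBigOWith, Filter.eventually_atTop] at hC
  obtain ⟨x₀, hx₀⟩ := hC
  obtain ⟨N₁, hN₁⟩ := exists_nat_ge (max x₀ 2)
  refine ⟨C, hC0, N₁, by exact_mod_cast (le_max_right x₀ 2).trans hN₁, fun n hn ↦ ?_⟩
  have hn' : x₀ ≤ (n : ℝ) := (le_max_left _ _).trans (hN₁.trans (by exact_mod_cast hn))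
  have hn2 : (2 : ℝ) ≤ n := (le_max_right _ _).trans (hN₁.trans (by exact_mod_cast hn))
  have h1 := hx₀ n hn'
  rw [Real.norm_eq_abs, Real.norm_eq_abs, Real.rpow_natCast] at h1
  have hlog : 0 < Real.log n := Real.log_pos (by linarith)
  have hq : 0 ≤ (n : ℝ) / Real.log n ^ (k + 2) := div_nonneg n.cast_nonneg (pow_nonneg hlog.le _)
  rw [abs_of_nonneg hq] at h1
  calc |ψ (n : ℝ) - n| ≤ C * ((n : ℝ) / Real.log n ^ (k + 2)) := h1
    _ = C * n / Real.log n ^ (k + 2) := by ring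

/-- `Σ_{m ≥ 3} 1/(m log² m)` has bounded partial sums (telescoping `1/log(m−1) − 1/log m`). [folklore] -/
private theorem summable_inv_mul_log_sq :
    Summable fun i : ℕ ↦ 1 / (((i : ℝ) + 3) * Real.log ((i : ℝ) + 3) ^ 2) := by
  have hstep : ∀ i : ℕ, 1 / (((i : ℝ) + 3) * Real.log ((i : ℝ) + 3) ^ 2) ≤
      1 / Real.log ((i : ℝ) + 2) - 1 / Real.log ((i : ℝ) + 3) := by
    intro i
    have hi : (0 : ℝ) ≤ i := i.cast_nonneg
    have hl2 : 0 < Real.log ((i : ℝ) + 2) := Real.log_pos (by linarith)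
    have hl3 : 0 < Real.log ((i : ℝ) + 3) := Real.log_pos (by linarith)
    have hle : Real.log ((i : ℝ) + 2) ≤ Real.log ((i : ℝ) + 3) := Real.log_le_log (by linarith) (by linarith)
    -- `log(i+3) − log(i+2) ≥ 1/(i+3)`
    have hdiff : 1 / ((i : ℝ) + 3) ≤ Real.log ((i : ℝ) + 3) - Real.log ((i : ℝ) + 2) := by
      rw [← Real.log_div (by linarith) (by linarith)]
      have := Real.one_sub_inv_le_log_of_pos (x := ((i : ℝ) + 3) / ((i : ℝ) + 2)) (by positivity)
      have e : 1 - (((i : ℝ) + 3) / ((i : ℝ) + 2))⁻¹ = 1 / ((i : ℝ) + 3) := by field_simp; ring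
      linarith
    rw [div_sub_div _ _ hl2.ne' hl3.ne', div_le_div_iff₀ (by positivity) (by positivity)]
    have h4 : 1 / ((i : ℝ) + 3) * (((i : ℝ) + 3) * Real.log ((i : ℝ) + 3) ^ 2) =
        Real.log ((i : ℝ) + 3) ^ 2 := by field_simp
    nlinarith [mul_le_mul_of_nonneg_right hdiff (by positivity :
      (0 : ℝ) ≤ ((i : ℝ) + 3) * Real.log ((i : ℝ) + 3) ^ 2), mul_le_mul_of_nonneg_left hle hl3.le]
  refine summable_of_sum_range_le (c := 1 / Real.log 2) (fun i ↦ by positivity) fun n ↦ ?_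
  calc ∑ i ∈ Finset.range n, 1 / (((i : ℝ) + 3) * Real.log ((i : ℝ) + 3) ^ 2)
      ≤ ∑ i ∈ Finset.range n, (1 / Real.log ((i : ℝ) + 2) - 1 / Real.log ((i : ℝ) + 3)) :=
        Finset.sum_le_sum fun i _ ↦ hstep i
    _ = 1 / Real.log 2 - 1 / Real.log ((n : ℝ) + 2) := by
        have := Finset.sum_range_sub' (fun i : ℕ ↦ 1 / Real.log ((i : ℝ) + 2)) n
        simp only [Nat.cast_add, Nat.cast_one] at this
        rw [show (fun i : ℕ ↦ 1 / Real.log ((i : ℝ) + 2) - 1 / Real.log ((i : ℝ) + 1 + 2)) =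
          fun i : ℕ ↦ 1 / Real.log ((i : ℝ) + 2) - 1 / Real.log ((i : ℝ) + 3) by funext i; ring_nf] at this
        rw [this]; simp
    _ ≤ 1 / Real.log 2 := by
        have : 0 < Real.log ((n : ℝ) + 2) := Real.log_pos (by have := n.cast_nonneg (α := ℝ); linarith)
        have := one_div_pos.2 this
        linarith

/-- Reindexing `Icc 1 N` by `range N`. [folklore] -/
private theorem sum_Icc_eq_sum_range' (g : ℕ → ℝ) (N : ℕ) :
    ∑ m ∈ Icc 1 N, g m = ∑ i ∈ Finset.range N, g (i + 1) := by
  rw [← Finset.Ico_add_one_right_eq_Icc, Finset.sum_Ico_eq_sum_range]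
  simp only [Nat.add_sub_cancel, add_comm 1]

/-- `f(m) − f(m+1) ≤ (log(m+1))^k (1/m − 1/(m+1))` for `m ≥ 1`. [folklore] -/
private theorem f_sub_f_succ_le (k : ℕ) {m : ℝ} (hm : 1 ≤ m) :
    (Real.log (m : ℝ) ^ k / (m : ℝ)) - (Real.log ((m + 1) : ℝ) ^ k / ((m + 1) : ℝ)) ≤ Real.log (m + 1) ^ k * (1 / m - 1 / (m + 1)) := by
  have h1 : Real.log m ^ k ≤ Real.log (m + 1) ^ k :=
    pow_le_pow_left₀ (Real.log_nonneg hm) (Real.log_le_log (by linarith) (by linarith)) k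
  have hm0 : 0 < m := by linarith
  have : Real.log m ^ k / m ≤ Real.log (m + 1) ^ k / m := div_le_div_of_nonneg_right h1 hm0.le
  have e : Real.log (m + 1) ^ k * (1 / m - 1 / (m + 1)) = Real.log (m + 1) ^ k / m - Real.log (m + 1) ^ k / (m + 1) := by
    ring
  linarith

/-- **Convergence of the prime part** `Σ_{i<N} f_k(i+1)(Λ(i+1) − 1)` (Abel summation against
`ψ(n) − n = O(n/log^{k+2} n)`). [folklore] -/
private theorem tendsto_v (k : ℕ) : ∃ L : ℝ,
    Tendsto (fun N : ℕ ↦ ∑ i ∈ Finset.range N, (Real.log (((i : ℝ) + 1) : ℝ) ^ k / (((i : ℝ) + 1) : ℝ)) * ((Λ (i + 1) : ℝ) - 1)) atTop (𝓝 L) := by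
  obtain ⟨C, hC0, N₁, hN₁2, hB⟩ := exists_bound_psi_sub k
  set w : ℕ → ℝ := fun i ↦ (Real.log (((i : ℝ) + 1) : ℝ) ^ k / (((i : ℝ) + 1) : ℝ)) with hw
  set c : ℕ → ℝ := fun i ↦ (Λ (i + 1) : ℝ) - 1 with hc
  set Cs : ℕ → ℝ := fun n ↦ ∑ i ∈ Finset.range n, c i with hCs
  have hCs : ∀ n, Cs n = ψ (n : ℝ) - n := fun n ↦ sum_range_vonMangoldt_sub_one n
  -- Abel summation
  have hparts : ∀ N, ∑ i ∈ Finset.range N, w i * c i =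
      w (N - 1) * Cs N - ∑ i ∈ Finset.range (N - 1), (w (i + 1) - w i) * Cs (i + 1) := by
    intro N
    have h := Finset.sum_range_by_parts w c N
    simpa only [smul_eq_mul] using h
  -- Claim 1: the boundary term tends to 0
  have hlog : Tendsto (fun N : ℕ ↦ Real.log (N : ℝ) ^ 2) atTop atTop :=
    (tendsto_pow_atTop two_ne_zero).comp (Real.tendsto_log_atTop.comp tendsto_natCast_atTop_atTop)
  have hbd : Tendsto (fun N : ℕ ↦ w (N - 1) * Cs N) atTop (𝓝 0) := by
    have hsmall : Tendsto (fun N : ℕ ↦ C / Real.log (N : ℝ) ^ 2) atTop (𝓝 0) :=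
      tendsto_const_nhds.div_atTop hlog
    refine squeeze_zero_norm' ?_ hsmall
    filter_upwards [Filter.eventually_ge_atTop N₁] with N hN
    have hN2 : (2 : ℝ) ≤ N := by exact_mod_cast hN₁2.trans hN
    have hN0 : (0 : ℝ) < N := by linarith
    have hlogN : 0 < Real.log N := Real.log_pos (by linarith)
    have hw' : w (N - 1) = Real.log N ^ k / N := by
      simp only [hw]
      have : (((N - 1 : ℕ) : ℝ) + 1) = N := by
        rw [Nat.cast_sub (by omega)]; push_cast; ring
      rw [this]
    rw [Real.norm_eq_abs, hw', hCs, abs_mul, abs_of_nonneg (by positivity)]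
    calc Real.log N ^ k / N * |ψ (N : ℝ) - N| ≤ Real.log N ^ k / N * (C * N / Real.log N ^ (k + 2)) :=
          mul_le_mul_of_nonneg_left (hB N hN) (by positivity)
      _ = C / Real.log N ^ 2 := by field_simp; ring
  -- Claim 2: the Abel series converges absolutely
  obtain ⟨M₀, hM₀⟩ := exists_nat_ge (Real.exp k)
  have hsumm : Summable fun i : ℕ ↦ (w (i + 1) - w i) * Cs (i + 1) := by
    have hg : Summable fun i : ℕ ↦ C * 2 ^ k * (1 / (((i : ℝ) + 1) * Real.log ((i : ℝ) + 1) ^ 2)) := by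
      rw [← summable_nat_add_iff 2]
      have := (summable_inv_mul_log_sq).mul_left (C * 2 ^ k)
      refine this.congr fun j ↦ ?_
      push_cast; ring_nf
    refine hg.of_norm_bounded_eventually_nat ?_
    filter_upwards [Filter.eventually_ge_atTop (max N₁ M₀)] with i hi
    have hiN : N₁ ≤ i := le_of_max_le_left hi
    have hiM : M₀ ≤ i := le_of_max_le_right hi
    have hi2 : (2 : ℝ) ≤ i := by exact_mod_cast hN₁2.trans hiN
    have hi0 : (0 : ℝ) < (i : ℝ) + 1 := by linarith
    have hexp : Real.exp k ≤ (i : ℝ) + 1 := hM₀.trans (by exact_mod_cast Nat.le_succ_of_le hiM)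
    -- sign of the difference: `w` is non-increasing from `exp k` on
    have hanti : w (i + 1) ≤ w i := by
      simp only [hw]
      push_cast
      exact f_antitoneOn k (Set.mem_Ici.2 hexp) (Set.mem_Ici.2 (by linarith)) (by linarith)
    have hdiff : w i - w (i + 1) ≤ Real.log ((i : ℝ) + 2) ^ k * (1 / ((i : ℝ) + 1) - 1 / ((i : ℝ) + 2)) := by
      simp only [hw]
      push_cast
      have := f_sub_f_succ_le k (m := (i : ℝ) + 1) (by linarith)
      rw [show (i : ℝ) + 1 + 1 = (i : ℝ) + 2 by ring] at this ⊢
      exact this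
    have hCb : |Cs (i + 1)| ≤ C * ((i : ℝ) + 1) / Real.log ((i : ℝ) + 1) ^ (k + 2) := by
      rw [hCs]
      have := hB (i + 1) (by omega)
      push_cast at this ⊢
      exact this
    have hlog1 : 0 < Real.log ((i : ℝ) + 1) := Real.log_pos (by linarith)
    have hlog2 : Real.log ((i : ℝ) + 2) ≤ 2 * Real.log ((i : ℝ) + 1) := by
      rw [show (2 : ℝ) * Real.log ((i : ℝ) + 1) = Real.log (((i : ℝ) + 1) ^ 2) by
        rw [Real.log_pow]; norm_num]
      exact Real.log_le_log (by linarith) (by nlinarith)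
    rw [Real.norm_eq_abs, abs_mul, show |w (i + 1) - w i| = w i - w (i + 1) by
      rw [abs_sub_comm]; exact abs_of_nonneg (by linarith)]
    have hlogk : Real.log ((i : ℝ) + 2) ^ k ≤ 2 ^ k * Real.log ((i : ℝ) + 1) ^ k := by
      rw [← mul_pow]; exact pow_le_pow_left₀ (Real.log_nonneg (by linarith)) hlog2 k
    calc (w i - w (i + 1)) * |Cs (i + 1)|
        ≤ (Real.log ((i : ℝ) + 2) ^ k * (1 / ((i : ℝ) + 1) - 1 / ((i : ℝ) + 2))) *
            (C * ((i : ℝ) + 1) / Real.log ((i : ℝ) + 1) ^ (k + 2)) :=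
          mul_le_mul hdiff hCb (abs_nonneg _) (by
            have : 1 / ((i : ℝ) + 2) ≤ 1 / ((i : ℝ) + 1) := one_div_le_one_div_of_le hi0 (by linarith)
            exact mul_nonneg (pow_nonneg (Real.log_nonneg (by linarith)) _) (by linarith))
      _ = Real.log ((i : ℝ) + 2) ^ k * (C / (((i : ℝ) + 2) * Real.log ((i : ℝ) + 1) ^ (k + 2))) := by
          field_simp; ring
      _ ≤ (2 ^ k * Real.log ((i : ℝ) + 1) ^ k) * (C / (((i : ℝ) + 2) * Real.log ((i : ℝ) + 1) ^ (k + 2))) :=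
          mul_le_mul_of_nonneg_right hlogk (by positivity)
      _ = C * 2 ^ k * (1 / (((i : ℝ) + 2) * Real.log ((i : ℝ) + 1) ^ 2)) := by
          field_simp; ring
      _ ≤ C * 2 ^ k * (1 / (((i : ℝ) + 1) * Real.log ((i : ℝ) + 1) ^ 2)) := by
          apply mul_le_mul_of_nonneg_left _ (by positivity)
          exact one_div_le_one_div_of_le (by positivity) (by nlinarith [pow_pos hlog1 2])
  -- conclusion
  refine ⟨0 - ∑' i, (w (i + 1) - w i) * Cs (i + 1), ?_⟩
  have hT : Tendsto (fun N : ℕ ↦ ∑ i ∈ Finset.range (N - 1), (w (i + 1) - w i) * Cs (i + 1)) atTop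
      (𝓝 (∑' i, (w (i + 1) - w i) * Cs (i + 1))) :=
    hsumm.hasSum.tendsto_sum_nat.comp (tendsto_sub_atTop_nat 1)
  have := hbd.sub hT
  refine this.congr fun N ↦ ?_
  rw [hparts N]

/-- **RH-FREE. The limits defining Bombieri–Lagarias' `η_k` exist** (the first clause of the
arithmetic formula, Bombieri–Lagarias 1999 Thm. 2; Coffey 2005 (11); Coffey 2010 (5):
`η_k = ((−1)^k/k!) lim_{N→∞} (Σ_{m≤N} Λ(m)(log m)^k/m − (log N)^{k+1}/(k+1))`): for every `k` the sequence
`Σ_{m≤N} Λ(m)(log m)^k/m − (log N)^{k+1}/(k+1)` converges as `N → ∞`. (This is literally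
`∃ L, Tendsto (liEtaSeq k) atTop (𝓝 L)` of `LiCoefficientArithmeticFormula.lean`.)
[cite: Coffey2010Eta, eq. (5)] -/
theorem tendsto_sum_vonMangoldt_log_pow_div_sub_exists (k : ℕ) : ∃ L : ℝ,
    Tendsto (fun N : ℕ ↦ (∑ m ∈ Icc 1 N, (Λ m : ℝ) * Real.log m ^ k / m) -
      Real.log N ^ (k + 1) / (k + 1)) atTop (𝓝 L) := by
  obtain ⟨Lu, hu⟩ := tendsto_sum_log_pow_div_sub_exists k
  obtain ⟨Lv, hv⟩ := tendsto_v k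
  refine ⟨Lu + Lv, (hu.add hv).congr fun N ↦ ?_⟩
  simp only [sum_Icc_eq_sum_range']
  have : ∀ i : ℕ, (Λ (i + 1) : ℝ) * Real.log ((i + 1 : ℕ) : ℝ) ^ k / ((i + 1 : ℕ) : ℝ) =
      (Real.log (((i + 1 : ℕ) : ℝ) : ℝ) ^ k / (((i + 1 : ℕ) : ℝ) : ℝ)) + (Real.log (((i : ℝ) + 1) : ℝ) ^ k / (((i : ℝ) + 1) : ℝ)) * ((Λ (i + 1) : ℝ) - 1) := by
    intro i
    push_cast
    ring
  simp only [this, Finset.sum_add_distrib]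
  push_cast
  ring


end Literature.NumberTheory.LFunctions
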